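import Literature.AlgebraicGeometry.ModuliOfAbelianVarieties.SymplecticLiftOfMarkedFibreCover   -- ★ p850782 (LA5-p02 (g4)): the exposed lift + `K_δ(N)` re-indexing
import Literature.AlgebraicGeometry.AbelianSchemes.IsLambdaOfAtAlongDualIsogeny                  -- ★ `weilDiv_pullback_fibreHom_linEquiv_nsmul_dualIsogeny'` (the divisor clause from (t3))
import Literature.AlgebraicGeometry.Limits.SurjectiveSpread                                      -- ★ `Limits.surjective_pullback_map_left` (surjectivity base-changes)
import HarnessLib

/-!
# The symplectic lift of a covered complex fibre from the GLOBAL cover rows: the witness `Θ′`, `IsLambdaOfAt`, and the exposed lift read through the target marking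

Topic `AlgebraicGeometry/ModuliOfAbelianVarieties`; namespace `Literature.AlgebraicGeometry.ModuliOfAbelianVarieties`.  THEOREMS ONLY (no definition, no named fact,
no instance, no notation, no `sorry`).  Cell `hodgecm-mathlib` (D-0151), FLOOR 0, P6 «MOD programme» (crux hLiu418 = stmt-HodgeConjecture-24832, `--supports`,
count-neutral); line «L4», (S8) sheet-line closer `Lines/F0_P6a_StubESHEET.lean`, road (γ′) «Serre tensor over `X`, classified», organ **DEAL #41 (B1) TOWER** (LA4-plan (g2)
2026-09-02 09:11:38Z (b); consumers LA7-p01 (g4) (B1) binder `∃ Θ, IsLambdaOfAt ∧ Nonempty (SymplecticLift …)` → `hT` (★ p850691) ∕ `hsymp` ((m1)), LA6-p02 (g3)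
(R-CM-3) letters `Θ₂ Λ₂ hΛ₂`): the GENERIC assembly over a homomorphism `c : B → B′` of abelian schemes over ANY base `S` with the two GLOBAL rows that matter —
(t3) `c ≫ λ′ ≫ c^∨ = λ ≫ [ν]` and (surj) `c` surjective — at a complex point `s₀` carrying a marked fibre `(m, Θ, readings)` of `B` and the quotient marking `m′` of
`B′` (`u′ = c_{s₀} ∘ u`):
* the witness `Θ′` of `λ′` at `s₀` is FREE (MFK Def. 6.3 is a field of `Polarization`: ★ `Polarization.exists_ample`), AMPLE;
* the divisor clause `D_Q(c_{s₀}^*Θ′) ∼ ν·D_Q(Θ)` is ★ `weilDiv_pullback_fibreHom_linEquiv_nsmul_dualIsogeny'` on (t3) ([MumfordAV1970] §23 «`Λ(ψ^*L) = ψ̂ Λ(L) ψ`»);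
* `c_{s₀}` is dominant because surjectivity base-changes (★ `Limits.surjective_pullback_map_left`);
* then ★ p850782 `exists_symplecticLift_of_markedComplexFibre_comp` gives the lift `Λ′` of `φ′(s₀)` for `Θ′` READ THROUGH `r` BY `m′`.

* **`SiegelAdelicMarking.exists_isLambdaOfAt_symplecticLift_of_cover`** — source readings `hpair`∕`hlevel` through `r′` given;
* **`SiegelAdelicMarking.exists_isLambdaOfAt_symplecticLift_of_cover_of_symplecticLift`** — source readings produced from a symplectic lift `Λ` of `φ(s₀)` for `Θ` read by
  `m` through `k·r′⁻¹`, `k ∈ K_δ(N)` (the ★ σ1-UNPACK p850665 shape), by ★ p850782 `exists_readings_of_symplecticLift_of_mem_principalLevelSubgroup`.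
Budgets: default heartbeats.

References: [MumfordFogartyKirwan1994] D. Mumford, J. Fogarty, F. Kirwan, *Geometric Invariant Theory* (3rd ed. 1994), Ch. 6 §2 Def. 6.3 (p. 120), (6.3) (p. 121);
[MumfordAV1970] D. Mumford, *Abelian Varieties* (1970), §20 pp. 184–186, §23 Thm. 2 p. 231; [Lan2013PELCompactifications] K.-W. Lan, *Arithmetic compactifications of
PEL-type Shimura varieties* (2013), §1.3.6 Lemma 1.3.6.5–1.3.6.6, Cor. 1.3.6.7 (pp. 81–82); [Deligne1971TravauxShimura] P. Deligne, *Travaux de Shimura* (1971), 4.12 (b)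
p. 149; [Milne2005ShimuraVarieties] J. S. Milne, *Introduction to Shimura varieties* (2005), §6 Thm. 6.11 pp. 74–75, §12 (63) p. 116.  HC_CM is proved only modulo the
printed citations (2 remaining named inputs hLiu418 24832, h413 24833) until rung 0 closes — count-neutral.
-/

set_option autoImplicit false

noncomputable section

open CategoryTheory AlgebraicGeometry Matrix NumberField IsDedekindDomain
open Literature.AlgebraicGeometry.Motives (AbelianVariety AlgPoints CartierDivisor)
open Literature.AlgebraicGeometry.AbelianSchemes (AbelianSchemeOver)

namespace Literature.AlgebraicGeometry.ModuliOfAbelianVarieties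

open SiegelModuli
open Literature.NumberTheory.Adeles (latticeOfGL)
open Literature.AlgebraicGeometry.AbelianSchemes.AbelianSchemeOver (DualPair)

/-- **THE LIFT OF A COVERED COMPLEX FIBRE FROM THE GLOBAL ROWS (t3) + (surj)** — for `c : B → B′` over `S` surjective with `c ≫ λ′ ≫ c^∨ = λ ≫ [ν]` (`ν ≠ 0`), level structures
`φ′ = φ ≫ c`, a complex point `s₀`, a witness `Θ` of `λ` at `s₀`, a marking `m` of `B_{s₀}` by `[J, r′]` with the readings `hpair`∕`hlevel` through `r′`, the quotient marking
`m′` of `B′_{s₀}` by `[J′, r]` (`u′ = c_{s₀} ∘ u`) and the transfer data `hT hμ hε hk` of `r′⁻¹ r`: THERE ARE an AMPLE witness `Θ′` of `λ′` at `s₀` (`IsLambdaOfAt`) and a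
symplectic lift `Λ′` of `φ′(s₀)` for `Θ′` of type `δ` whose tower is read through `r` by `m′`.
[cite: MumfordFogartyKirwan1994, Ch. 6 §2 Definition 6.3 (p. 120) and (6.3) (p. 121)] [cite: MumfordAV1970, §23 (Thm. 2, p. 231)]
[cite: Lan2013PELCompactifications, §1.3.6 Lemma 1.3.6.5 (p. 81), Lemma 1.3.6.6 and Cor. 1.3.6.7 (pp. 81–82)] [cite: Milne2005ShimuraVarieties, §6 Thm. 6.11 p. 74 and §12 (63) p. 116] -/
theorem SiegelAdelicMarking.exists_isLambdaOfAt_symplecticLift_of_cover {g : ℕ} {δ : Fin g → ℕ}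
    {J J' : C0pm δ} {r' r : gspFinAdelic δ}
    {S : Scheme.{0}} {B B' : AbelianSchemeOver S} {N : ℕ} (φ : B.LevelStructure g N) (φ' : B'.LevelStructure g N)
    (c : B.X ⟶ B'.X) [IsMonHom c] [Surjective c.left] (hφ' : ∀ i, φ'.σ i = φ.σ i ≫ c)
    {D : B.DualPair} {D' : B'.DualPair} (pol : B.Polarization D) (pol' : B'.Polarization D') {ν : ℕ} (hν : ν ≠ 0)
    (ht3 : c ≫ pol'.lam ≫ DualPair.dualIsogenyOver c D D' = pol.lam ≫ D.hat.mulN ν)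
    {s₀ : Spec (.of ℂ) ⟶ S} (Θ : CartierDivisor (B.fibre s₀).toAbelianVariety.X.left) (hΘ : B.IsLambdaOfAt s₀ D pol.lam Θ)
    (m : SiegelAdelicMarking J r' (B.fibre s₀).toAbelianVariety) (m' : SiegelAdelicMarking J' r (B'.fibre s₀).toAbelianVariety)
    (hm' : ∀ v, m'.r v = AlgPoints.map (AbelianSchemeOver.fibreHom c s₀).hom.hom.hom (m.r v))
    (hT : ∀ i j, (ν : finAdeleQ) *
      (((r'⁻¹ * r : gspFinAdelic δ) : GL (Fin g ⊕ Fin g) finAdeleQ) : Matrix (Fin g ⊕ Fin g) (Fin g ⊕ Fin g) finAdeleQ) i j ∈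
        FiniteAdeleRing.integralAdeles (𝓞 ℚ) ℚ)
    {μ : finAdeleQˣ} (hμ : IsMultiplier (typeFormOver δ finAdeleQ) ((r'⁻¹ * r : gspFinAdelic δ) : GL (Fin g ⊕ Fin g) finAdeleQ) μ)
    (ε : (FiniteAdeleRing.integralAdeles (𝓞 ℚ) ℚ)ˣ)
    (hε : ((ε : FiniteAdeleRing.integralAdeles (𝓞 ℚ) ℚ) : finAdeleQ) = (ν : finAdeleQ) * (μ : finAdeleQ))
    (hk : ∀ i j, ∃ t ∈ FiniteAdeleRing.integralAdeles (𝓞 ℚ) ℚ,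
      ((((r⁻¹ * r' : gspFinAdelic δ) : GL (Fin g ⊕ Fin g) finAdeleQ) : Matrix (Fin g ⊕ Fin g) (Fin g ⊕ Fin g) finAdeleQ) - 1) i j =
        (N : finAdeleQ) * t)
    (ζ : ℕ → ℂ) (hζ : ∀ ⦃M : ℕ⦄, N ∣ M → M ≠ 0 → IsPrimitiveRoot (ζ M) M)
    (hζ_pow : ∀ ⦃M : ℕ⦄ (k : ℕ), N ∣ M → M ≠ 0 → k ≠ 0 → ζ (k * M) ^ k = ζ M)
    (hpair : ∀ ⦃M : ℕ⦄, N ∣ M → ∀ (hMΩ : (M : ℂ) ≠ 0) (x y : Fin g ⊕ Fin g → ZMod M)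
      (P Q : (B.fibre s₀).toAbelianVariety.torsionPoints ℂ (M : ℤ)),
      (∀ v, AdelicCongr ((r'⁻¹ : gspFinAdelic δ) : GL (Fin g ⊕ Fin g) finAdeleQ) 1 v
          (fun i => ((x i).val : ℚ) / M) → (P : (B.fibre s₀).toAbelianVariety.Points ℂ) = m.r v) →
      (∀ w, AdelicCongr ((r'⁻¹ : gspFinAdelic δ) : GL (Fin g ⊕ Fin g) finAdeleQ) 1 w
          (fun i => ((y i).val : ℚ) / M) → (Q : (B.fibre s₀).toAbelianVariety.Points ℂ) = m.r w) →
      haveI := AbelianVariety.isDominant_toSchemeHom_zsmul_of_ne_zero (B.fibre s₀).toAbelianVariety hMΩ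
      (B.fibre s₀).toAbelianVariety.weilPairingLevel Θ P Q = ζ M ^ (AbelianSchemeOver.typeFormMod δ M x y).val)
    (hlevel : ∀ i : Fin g ⊕ Fin g, ∃ v : Fin g ⊕ Fin g → ℚ,
      AdelicCongr ((r'⁻¹ : gspFinAdelic δ) : GL (Fin g ⊕ Fin g) finAdeleQ) 1 v
          (fun j => (((Pi.single i (1 : ZMod N) : Fin g ⊕ Fin g → ZMod N) j).val : ℚ) / N) ∧
        B.restrictPt s₀ (φ.σ i) = m.r v) :
    ∃ Θ' : CartierDivisor (B'.fibre s₀).toAbelianVariety.X.left, Θ'.IsAmple ∧ B'.IsLambdaOfAt s₀ D' pol'.lam Θ' ∧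
      ∃ Λ' : φ'.SymplecticLift s₀ Θ' δ,
        ∀ ⦃M : ℕ⦄, N ∣ M → M ≠ 0 → ∀ (x : Fin g ⊕ Fin g → ZMod M) (v : Fin g ⊕ Fin g → ℚ),
          AdelicCongr ((r⁻¹ : gspFinAdelic δ) : GL (Fin g ⊕ Fin g) finAdeleQ) 1 v (fun i => ((x i).val : ℚ) / M) →
            ((Λ'.lift M (Multiplicative.ofAdd x)) : (B'.fibre s₀).toAbelianVariety.Points ℂ) = m'.r v := by
  -- the witness of `λ′` at `s₀` (MFK Def. 6.3)
  obtain ⟨Θ', hamp, hΘ'⟩ := pol'.exists_ample ℂ s₀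
  -- `c_{s₀}` is dominant: surjectivity base-changes
  haveI : Surjective ((Over.pullback s₀).map c).left := Literature.AlgebraicGeometry.Limits.surjective_pullback_map_left s₀ c
  haveI : IsDominant (AbelianVariety.Hom.toSchemeHom (AbelianSchemeOver.fibreHom c s₀)) := by
    change IsDominant ((Over.pullback s₀).map c).left
    infer_instance
  -- the divisor clause from (t3)
  haveI := pol.isMonHom
  have hdiv : ∀ Q : (B.fibre s₀).toAbelianVariety.Points ℂ,
      ((B.fibre s₀).toAbelianVariety.weilDiv (Θ'.pullback (AbelianVariety.Hom.toSchemeHom (AbelianSchemeOver.fibreHom c s₀))) Q).LinEquiv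
        (ν • (B.fibre s₀).toAbelianVariety.weilDiv Θ Q) := fun Q =>
    AbelianSchemeOver.weilDiv_pullback_fibreHom_linEquiv_nsmul_dualIsogeny' c D D' s₀ pol'.lam ht3 hΘ hΘ' Q
  obtain ⟨Λ', hΛ'⟩ := SiegelAdelicMarking.exists_symplecticLift_of_markedComplexFibre_comp φ φ' c hφ' Θ Θ' hν hdiv m m' hm' hT hμ ε hε hk
    ζ hζ hζ_pow hpair hlevel
  exact ⟨Θ', hamp, hΘ', Λ', hΛ'⟩

/-- **THE SAME FROM A SYMPLECTIC LIFT OF THE SOURCE READ THROUGH `k·r′⁻¹`, `k ∈ K_δ(N)`** (the ★ σ1-UNPACK p850665 shape: `m` indexed by the moved representative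
`r′ = rep·k`, `Λ` read through `rep⁻¹ = k·r′⁻¹`): ★ p850782 `exists_readings_of_symplecticLift_of_mem_principalLevelSubgroup` supplies `hpair`∕`hlevel` through `r′⁻¹`,
then `exists_isLambdaOfAt_symplecticLift_of_cover`. [cite: Deligne1971TravauxShimura, 4.12 (b) p. 149] [cite: Lan2013PELCompactifications, §1.3.6 Lemma 1.3.6.5 (p. 81) and Cor. 1.3.6.7 (p. 82)]
[cite: MumfordFogartyKirwan1994, Ch. 6 §2 Definition 6.3 (p. 120)] [cite: MumfordAV1970, §23 (Thm. 2, p. 231)] -/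
theorem SiegelAdelicMarking.exists_isLambdaOfAt_symplecticLift_of_cover_of_symplecticLift {g : ℕ} {δ : Fin g → ℕ}
    (hδ : IsPolarizationType δ) (hg : 0 < g) {J J' : C0pm δ} {r' r k : gspFinAdelic δ}
    {S : Scheme.{0}} {B B' : AbelianSchemeOver S} [IsCommMonObj B.X] {N : ℕ} (hN : N ≠ 0) (hkN : k ∈ principalLevelSubgroup δ N)
    (φ : B.LevelStructure g N) (φ' : B'.LevelStructure g N)
    (c : B.X ⟶ B'.X) [IsMonHom c] [Surjective c.left] (hφ' : ∀ i, φ'.σ i = φ.σ i ≫ c)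
    {D : B.DualPair} {D' : B'.DualPair} (pol : B.Polarization D) (pol' : B'.Polarization D') {ν : ℕ} (hν : ν ≠ 0)
    (ht3 : c ≫ pol'.lam ≫ DualPair.dualIsogenyOver c D D' = pol.lam ≫ D.hat.mulN ν)
    {s₀ : Spec (.of ℂ) ⟶ S} (Θ : CartierDivisor (B.fibre s₀).toAbelianVariety.X.left) (hΘ : B.IsLambdaOfAt s₀ D pol.lam Θ)
    (Λ : φ.SymplecticLift s₀ Θ δ)
    (m : SiegelAdelicMarking J r' (B.fibre s₀).toAbelianVariety) (m' : SiegelAdelicMarking J' r (B'.fibre s₀).toAbelianVariety)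
    (hread : ∀ ⦃M : ℕ⦄, N ∣ M → M ≠ 0 → ∀ (x : Fin g ⊕ Fin g → ZMod M) (v : Fin g ⊕ Fin g → ℚ),
      AdelicCongr ((k * r'⁻¹ : gspFinAdelic δ) : GL (Fin g ⊕ Fin g) finAdeleQ) 1 v (fun i => ((x i).val : ℚ) / M) →
        ((Λ.lift M (Multiplicative.ofAdd x)) : (B.fibre s₀).toAbelianVariety.Points ℂ) = m.r v)
    (hm' : ∀ v, m'.r v = AlgPoints.map (AbelianSchemeOver.fibreHom c s₀).hom.hom.hom (m.r v))
    (hT : ∀ i j, (ν : finAdeleQ) *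
      (((r'⁻¹ * r : gspFinAdelic δ) : GL (Fin g ⊕ Fin g) finAdeleQ) : Matrix (Fin g ⊕ Fin g) (Fin g ⊕ Fin g) finAdeleQ) i j ∈
        FiniteAdeleRing.integralAdeles (𝓞 ℚ) ℚ)
    {μ : finAdeleQˣ} (hμ : IsMultiplier (typeFormOver δ finAdeleQ) ((r'⁻¹ * r : gspFinAdelic δ) : GL (Fin g ⊕ Fin g) finAdeleQ) μ)
    (ε : (FiniteAdeleRing.integralAdeles (𝓞 ℚ) ℚ)ˣ)
    (hε : ((ε : FiniteAdeleRing.integralAdeles (𝓞 ℚ) ℚ) : finAdeleQ) = (ν : finAdeleQ) * (μ : finAdeleQ))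
    (hk : ∀ i j, ∃ t ∈ FiniteAdeleRing.integralAdeles (𝓞 ℚ) ℚ,
      ((((r⁻¹ * r' : gspFinAdelic δ) : GL (Fin g ⊕ Fin g) finAdeleQ) : Matrix (Fin g ⊕ Fin g) (Fin g ⊕ Fin g) finAdeleQ) - 1) i j =
        (N : finAdeleQ) * t) :
    ∃ Θ' : CartierDivisor (B'.fibre s₀).toAbelianVariety.X.left, Θ'.IsAmple ∧ B'.IsLambdaOfAt s₀ D' pol'.lam Θ' ∧
      ∃ Λ' : φ'.SymplecticLift s₀ Θ' δ,
        ∀ ⦃M : ℕ⦄, N ∣ M → M ≠ 0 → ∀ (x : Fin g ⊕ Fin g → ZMod M) (v : Fin g ⊕ Fin g → ℚ),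
          AdelicCongr ((r⁻¹ : gspFinAdelic δ) : GL (Fin g ⊕ Fin g) finAdeleQ) 1 v (fun i => ((x i).val : ℚ) / M) →
            ((Λ'.lift M (Multiplicative.ofAdd x)) : (B'.fibre s₀).toAbelianVariety.Points ℂ) = m'.r v := by
  obtain ⟨ζ, hζ, hζ_pow, hpair, hlevel⟩ :=
    SiegelAdelicMarking.exists_readings_of_symplecticLift_of_mem_principalLevelSubgroup hδ hg hN hkN φ Θ Λ m hread
  exact SiegelAdelicMarking.exists_isLambdaOfAt_symplecticLift_of_cover φ φ' c hφ' pol pol' hν ht3 Θ hΘ m m' hm' hT hμ ε hε hk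
    ζ hζ hζ_pow hpair hlevel

end Literature.AlgebraicGeometry.ModuliOfAbelianVarieties

end
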